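import Summits.Parity.GeneralizedHardyLittlewood.Theorems.BeyondDiagonalBeatsQuarter.OffDiagPrincipalShort
import Summits.Parity.GeneralizedHardyLittlewood.Theorems.BeyondDiagonalBeatsQuarter.OffDiagDualCompletionTwisted
import Summits.Parity.GeneralizedHardyLittlewood.Theorems.BeyondDiagonalBeatsQuarter.OffDiagLevelCharSplit
import Mathlib.Analysis.Fourier.ZMod
import HarnessLib

/-!
# Route `PrimeLevelFamEdge`, crux K_B (stmt-Parity-20343), line `diagonal_kernel_split` rev 4, plan Ω, sub-line Ω-g
# (OMEGA-BLUEPRINT a8S, the small-conductor part) — **the CHARACTER BLOCK TERM of one dual modulus: a TWISTED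
# complete `s`-sum is a Gauss/DFT-weighted sum of lattice SAMPLES of the box weight** (twin of `OffDiagPrincipalBlock`)

Setting (GATE G2 §(a) a8 after the block switch, `OffDiagBlockStrata.sum_levels_switch_eq_levelAPSum`): for a fixed
signed dual modulus `h₁ ≠ 0` (`n = |h₁|`), the levels `q` of the block run, for each `s ∈ ℤ`, over ONE class
`a(s) = −ab·(cs)⁻¹ (mod n)`; the weight is `x_s(q) = Φ̂_q(ξ₁ q, s/h₁ + τ q)`. `OffDiagLevelCharSplit` expands the class sum in
characters: `levelAPSum = levelPrincipal + levelSmallPart R + levelLargePart R`; the principal term summed over `s` is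
`OffDiagPrincipalBlock` (complete `s`-sums ⇒ samples of the box weight at the heights `|h₁|k`, VOID for `|h₁| ≥` box
height). Here the same computation for a character (indeed for ANY weight `w` that is a function of `s mod n`): the
twist `s ↦ χ(a(s)⁻¹)` is `n`-periodic, its discrete Fourier expansion (Mathlib `ZMod.dft`, inversion `ZMod.invDFT_apply`)
turns `Σ_s w(s)·Φ̂(ξ₁, s/n + τ)` into additively twisted complete sums, and each of those SAMPLES the box weight at the
heights `y₂ ≡ j (mod n)` (`OffDiagDualCompletionTwisted.tsum_fourierChar_mul_fourier2_shift_eq(_single)`):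

* `twist_intCast_eq_sum_dft` — `w(s mod n) = n⁻¹ Σ_{j mod n} (𝓕w)(j)·e(j·s/n)` along `ℤ`;
* `summable_twist_mul_fourier2_shift` — the twisted `s`-series are summable;
* **`tsum_twist_mul_fourier2_shift_eq`** — `Σ_{s∈ℤ} w(s)·Φ̂(ξ₁, s/n + τ) = Σ_{j mod n} (𝓕w)(j)·e(−jτ)·Σ_{k∈ℤ} e(−τnk)·
  𝓕(t₁ ↦ Φ(t₁, nk + j))(ξ₁)` (`j` read in `[0, n)`), and for a box below height `n` (`Φ ≠ 0 ⇒ 0 < t₂ < n`)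
  **`tsum_twist_mul_fourier2_shift_eq_samples`**: `= Σ_{j mod n} (𝓕w)(j)·e(−jτ)·𝓕(t₁ ↦ Φ(t₁, j))(ξ₁)` — ONE sample per
  residue, only the heights `j` inside the box survive (`…_eq_sum_filter`);
* the VOID mechanism, in its true generality: `dft_eq_zero_of_periodic` — if `w` has a period `d` in `ZMod n` then
  `(𝓕w)(j) = 0` unless `d·j = 0`, i.e. the samples sit on the lattice of spacing `n/d`; **`tsum_twist_eq_zero_of_periodic`**
  — hence the twisted block term VANISHES when the box lives below height `n/d`-spacing's first point (hypothesis form: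
  `(𝓕w)(j) = 0` for every `j` with `0 < j < B`). For the trivial twist (`d = 1`) this is `principalBlock_eq_zero_of_height_le`;
  for a PRIMITIVE character `χ mod n` Mathlib's `DirichletCharacter.IsPrimitive.fourierTransform_eq_inv_mul_gaussSum` gives
  `(𝓕χ)(j) = χ⁻¹(−j)·τ(χ)` — samples at EVERY height with a Gauss-sum factor (`tsum_char_mul_fourier2_shift_eq_samples`).
  CAVEAT recorded for the planner: a character `χ mod n` of conductor `d₀ < n` is NOT `d₀`-periodic as a function on
  `ℤ/n` unless every prime of `n` divides `d₀` (it vanishes on the non-units of `n`), so «VOID for `|h₁| ≥ cond·B`» holds for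
  the `d₀`-periodic part only; in general (Montgomery–Vaughan Thm 9.12) the small-conductor block samples ALL heights in
  the box with coefficients of size `≍ √d₀` — the a8S object has the SHAPE of the short-moduli principal block (a8P-short)
  twisted by `χ̄*`, on every dual modulus, not only the short ones.
* signed moduli: `tsum_twist_intShift_eq_natAbs` (re-index `s ↦ −s` for `h₁ < 0`);
* the assembled a8S object: **`tsum_levelSmallPart_eq_sum_twist`** — for classes `a(s) = A(s mod n)`,
  `Σ'_s levelSmallPart R G x_s n (a s) = φ(n)⁻¹ Σ_{χ: 1<cond χ≤R} Σ_{q∈G} χ(q)·Σ'_s χ((A s)⁻¹)·Φ̂_q(ξ₁ q, s/h₁ + τ q)`, to which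
  the bullets above apply with `w = χ ∘ (·)⁻¹ ∘ A`.

Identities only — NO bound (the bound is the unfunded (S) of the blueprint). Standard axioms; helper toward
`stub_offDiagBelowSlack_io`; closes nothing.
«The programme SEARCHES and TYPES; no claim about Landau–Siegel zeros, Theorems 1–2 of arXiv:2211.02515 or
a repaired Margin232 until a kernel theorem says so.»
-/

noncomputable section

open Real MeasureTheory Filter Complex Finset
open scoped FourierTransform Topology ContDiff

namespace Summit.Parity.GeneralizedHardyLittlewood.Theorems.BeyondDiagonalBeatsQuarter.OffDiag

open Literature.NumberTheory.Sieve.FriedlanderIwaniecPrimes (fourier2)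

/-! ### §1 The discrete Fourier expansion of an `n`-periodic twist along `ℤ` -/

section DFT

variable {n : ℕ} [NeZero n]

/-- The standard additive character of `ℤ/n` at an integer, in the `e(·)` notation of the Ω files:
`stdAddChar (m mod n) = e(m/n)`. [folklore] -/
theorem stdAddChar_intCast_eq_fourierChar (m : ℤ) :
    (ZMod.stdAddChar (m : ZMod n) : ℂ) = (𝐞 ((m : ℝ) / n) : ℂ) := by
  rw [ZMod.stdAddChar_coe, Real.fourierChar_apply]
  congr 1
  push_cast
  ring

/-- **Discrete Fourier expansion of a twist along `ℤ`** (Mathlib `ZMod.dft`, inversion `ZMod.invDFT_apply`): for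
`w : ℤ/n → ℂ` and `s ∈ ℤ`, `w(s mod n) = n⁻¹ Σ_{j mod n} (𝓕w)(j)·e(j·s/n)` with `j` read as `j.val ∈ [0, n)`. [folklore] -/
theorem twist_intCast_eq_sum_dft (w : ZMod n → ℂ) (s : ℤ) :
    w (s : ZMod n) = (n : ℂ)⁻¹ * ∑ j : ZMod n, ZMod.dft w j * (𝐞 ((j.val : ℝ) * ((s : ℝ) / n)) : ℂ) := by
  have hinv : w = ZMod.dft.symm (ZMod.dft w) := (LinearEquiv.symm_apply_apply _ _).symm
  conv_lhs => rw [hinv]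
  rw [ZMod.invDFT_apply, smul_eq_mul]
  congr 1
  refine Finset.sum_congr rfl fun j _ ↦ ?_
  rw [smul_eq_mul, mul_comm]
  congr 1
  have : (j : ZMod n) * (s : ZMod n) = (((j.val : ℤ) * s : ℤ) : ZMod n) := by
    push_cast
    rw [ZMod.natCast_zmod_val]
  rw [this, stdAddChar_intCast_eq_fourierChar]
  congr 2
  push_cast
  ring

/-- **The DFT of a periodic twist is supported on a lattice**: if `w(x + d) = w(x)` for all `x ∈ ℤ/n`, then
`(𝓕w)(j) = 0` unless `d·j = 0` in `ℤ/n` (for `d ∣ n`: unless `(n/d) ∣ j`). [folklore] -/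
theorem dft_eq_zero_of_periodic {w : ZMod n → ℂ} {d : ZMod n} (hw : ∀ x, w (x + d) = w x) {j : ZMod n}
    (hj : d * j ≠ 0) : ZMod.dft w j = 0 := by
  have hshift : ZMod.dft w j = ZMod.stdAddChar (-(d * j)) * ZMod.dft w j := by
    rw [ZMod.dft_apply]
    conv_lhs => rw [← Equiv.sum_comp (Equiv.addRight d)]
    simp only [Equiv.coe_addRight, smul_eq_mul, Finset.mul_sum]
    refine Finset.sum_congr rfl fun x _ ↦ ?_
    rw [hw, add_mul, neg_add, AddChar.map_add_eq_mul]
    ring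
  have hne : ZMod.stdAddChar (-(d * j)) ≠ (1 : ℂ) := by
    intro h
    rw [← (ZMod.stdAddChar (N := n)).map_zero_eq_one] at h
    exact hj (neg_eq_zero.mp (ZMod.injective_stdAddChar h))
  have : (1 - ZMod.stdAddChar (-(d * j))) * ZMod.dft w j = 0 := by
    rw [sub_mul, one_mul, ← hshift, sub_self]
  rcases mul_eq_zero.mp this with h | h
  · exact absurd (sub_eq_zero.mp h).symm hne
  · exact h

/-- For a PRIMITIVE Dirichlet character the DFT is a Gauss sum times `χ⁻¹`: `(𝓕χ)(j) = χ⁻¹(−j)·τ(χ)`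
(Mathlib `DirichletCharacter.IsPrimitive.fourierTransform_eq_inv_mul_gaussSum`, restated in this file's spelling).
[folklore] -/
theorem dft_eq_of_isPrimitive {χ : DirichletCharacter ℂ n} (hχ : χ.IsPrimitive) (j : ZMod n) :
    ZMod.dft (χ : ZMod n → ℂ) j = χ⁻¹ (-j) * gaussSum χ ZMod.stdAddChar :=
  hχ.fourierTransform_eq_inv_mul_gaussSum j

end DFT

/-! ### §2 Twisted complete `s`-sums of a box transform -/

section Twisted

variable {Φ : ℝ → ℝ → ℂ} {n : ℕ} [NeZero n]

/-- The additively twisted `s`-series `s ↦ c(s)·Φ̂(ξ₁, s/n + τ)` is summable for any bounded twist `‖c s‖ ≤ M`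
(absolute summability from `OffDiagPrincipalShort.summable_fourier2_intShift` in finite dimension). [folklore] -/
theorem summable_twist_mul_fourier2_shift (hΦ : ContDiff ℝ ∞ (Function.uncurry Φ))
    (hΦc : HasCompactSupport (Function.uncurry Φ)) {h₁ : ℤ} (hh : h₁ ≠ 0) (τ ξ₁ : ℝ) {c : ℤ → ℂ} {M : ℝ}
    (hc : ∀ s, ‖c s‖ ≤ M) :
    Summable fun s : ℤ ↦ c s * fourier2 Φ ξ₁ ((s : ℝ) / h₁ + τ) := by
  have hs := summable_fourier2_intShift hΦ hΦc hh τ ξ₁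
  have hnorm : Summable fun s : ℤ ↦ ‖fourier2 Φ ξ₁ ((s : ℝ) / h₁ + τ)‖ := summable_norm_iff.mpr hs
  have hM : 0 ≤ M := (norm_nonneg _).trans (hc 0)
  refine Summable.of_norm_bounded (g := fun s : ℤ ↦ M * ‖fourier2 Φ ξ₁ ((s : ℝ) / h₁ + τ)‖) (hnorm.mul_left M)
    fun s ↦ ?_
  rw [norm_mul]
  exact mul_le_mul_of_nonneg_right (hc s) (norm_nonneg _)

/-- **The twisted complete `s`-sum is a DFT-weighted sum of additively twisted complete sums, hence of lattice
samples.** For `uncurry Φ` smooth of compact support, `n ≥ 1`, a twist `w : ℤ/n → ℂ`, `τ, ξ₁ ∈ ℝ`: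
`Σ_{s∈ℤ} w(s)·Φ̂(ξ₁, s/n + τ) = Σ_{j mod n} (𝓕w)(j)·e(−jτ)·Σ_{k∈ℤ} e(−τnk)·𝓕(t₁ ↦ Φ(t₁, nk + j))(ξ₁)` (`j = j.val`).
[folklore] -/
theorem tsum_twist_mul_fourier2_shift_eq (hΦ : ContDiff ℝ ∞ (Function.uncurry Φ))
    (hΦc : HasCompactSupport (Function.uncurry Φ)) (w : ZMod n → ℂ) (τ ξ₁ : ℝ) :
    ∑' s : ℤ, w (s : ZMod n) * fourier2 Φ ξ₁ ((s : ℝ) / n + τ) =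
      ∑ j : ZMod n, ZMod.dft w j * ((𝐞 (-((j.val : ℝ) * τ)) : ℂ) *
        ∑' k : ℤ, (𝐞 (-(τ * (n * k))) : ℂ) * 𝓕 (fun t₁ : ℝ ↦ Φ t₁ (n * k + j.val)) ξ₁) := by
  have hn : 0 < n := NeZero.pos n
  have hnz : ((n : ℕ) : ℤ) ≠ 0 := by exact_mod_cast hn.ne'
  -- expand the twist and exchange the finite `j`-sum with the `s`-series
  have hexp : ∀ s : ℤ, w (s : ZMod n) * fourier2 Φ ξ₁ ((s : ℝ) / n + τ) =
      ∑ j : ZMod n, (n : ℂ)⁻¹ * ZMod.dft w j *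
        ((𝐞 ((j.val : ℝ) * ((s : ℝ) / n)) : ℂ) * fourier2 Φ ξ₁ ((s : ℝ) / n + τ)) := by
    intro s
    rw [twist_intCast_eq_sum_dft w s, Finset.mul_sum, Finset.sum_mul]
    exact Finset.sum_congr rfl fun j _ ↦ by ring
  simp_rw [hexp]
  have hsumm : ∀ j ∈ (Finset.univ : Finset (ZMod n)), Summable fun s : ℤ ↦ (n : ℂ)⁻¹ * ZMod.dft w j *
      ((𝐞 ((j.val : ℝ) * ((s : ℝ) / n)) : ℂ) * fourier2 Φ ξ₁ ((s : ℝ) / n + τ)) := by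
    intro j _
    have h := summable_twist_mul_fourier2_shift hΦ hΦc hnz τ ξ₁ (M := 1)
      (c := fun s : ℤ ↦ (𝐞 ((j.val : ℝ) * ((s : ℝ) / n)) : ℂ)) (fun s ↦ by rw [Circle.norm_coe])
    push_cast at h
    exact h.mul_left _
  rw [Summable.tsum_finsetSum hsumm]
  refine Finset.sum_congr rfl fun j _ ↦ ?_
  rw [tsum_mul_left, mul_assoc]
  have h2 := tsum_fourierChar_mul_fourier2_shift_eq hΦ hΦc hn τ (j.val : ℝ) ξ₁
  rw [h2]
  have hn0 : (n : ℂ) ≠ 0 := by exact_mod_cast hn.ne'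
  field_simp

/-- **One sample per residue for a box below height `n`.** If moreover `Φ(t₁,t₂) ≠ 0 ⇒ 0 < t₂ < n`, then
`Σ_{s∈ℤ} w(s)·Φ̂(ξ₁, s/n + τ) = Σ_{j mod n} (𝓕w)(j)·e(−jτ)·𝓕(t₁ ↦ Φ(t₁, j))(ξ₁)` — the character block term samples the
box weight at the INTEGER heights `j ∈ [0, n)`, each with the DFT coefficient of the twist. [folklore] -/
theorem tsum_twist_mul_fourier2_shift_eq_samples (hΦ : ContDiff ℝ ∞ (Function.uncurry Φ))
    (hΦc : HasCompactSupport (Function.uncurry Φ))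
    (hsupp : ∀ t₁ t₂, Φ t₁ t₂ ≠ 0 → 0 < t₂ ∧ t₂ < n) (w : ZMod n → ℂ) (τ ξ₁ : ℝ) :
    ∑' s : ℤ, w (s : ZMod n) * fourier2 Φ ξ₁ ((s : ℝ) / n + τ) =
      ∑ j : ZMod n, ZMod.dft w j * ((𝐞 (-((j.val : ℝ) * τ)) : ℂ) * 𝓕 (fun t₁ : ℝ ↦ Φ t₁ j.val) ξ₁) := by
  have hn : 0 < n := NeZero.pos n
  have hnz : ((n : ℕ) : ℤ) ≠ 0 := by exact_mod_cast hn.ne'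
  have hexp : ∀ s : ℤ, w (s : ZMod n) * fourier2 Φ ξ₁ ((s : ℝ) / n + τ) =
      ∑ j : ZMod n, (n : ℂ)⁻¹ * ZMod.dft w j *
        ((𝐞 ((j.val : ℝ) * ((s : ℝ) / n)) : ℂ) * fourier2 Φ ξ₁ ((s : ℝ) / n + τ)) := by
    intro s
    rw [twist_intCast_eq_sum_dft w s, Finset.mul_sum, Finset.sum_mul]
    exact Finset.sum_congr rfl fun j _ ↦ by ring
  simp_rw [hexp]
  have hsumm : ∀ j ∈ (Finset.univ : Finset (ZMod n)), Summable fun s : ℤ ↦ (n : ℂ)⁻¹ * ZMod.dft w j *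
      ((𝐞 ((j.val : ℝ) * ((s : ℝ) / n)) : ℂ) * fourier2 Φ ξ₁ ((s : ℝ) / n + τ)) := by
    intro j _
    have h := summable_twist_mul_fourier2_shift hΦ hΦc hnz τ ξ₁ (M := 1)
      (c := fun s : ℤ ↦ (𝐞 ((j.val : ℝ) * ((s : ℝ) / n)) : ℂ)) (fun s ↦ by rw [Circle.norm_coe])
    push_cast at h
    exact h.mul_left _
  rw [Summable.tsum_finsetSum hsumm]
  refine Finset.sum_congr rfl fun j _ ↦ ?_
  rw [tsum_mul_left, mul_assoc]
  have hj0 : (0 : ℝ) ≤ (j.val : ℝ) := Nat.cast_nonneg _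
  have hjn : (j.val : ℝ) < n := by exact_mod_cast ZMod.val_lt j
  have h2 := tsum_fourierChar_mul_fourier2_shift_eq_single hΦ hΦc hn hsupp hj0 hjn τ ξ₁
  rw [h2]
  have hn0 : (n : ℂ) ≠ 0 := by exact_mod_cast hn.ne'
  field_simp

/-- **Only the heights inside the box survive**: if `Φ(t₁,t₂) ≠ 0 ⇒ B₀ < t₂ < B` with `0 ≤ B₀` and `B ≤ n`, then
`Σ_{s∈ℤ} w(s)·Φ̂(ξ₁, s/n + τ) = Σ_{j mod n, B₀ < j < B} (𝓕w)(j)·e(−jτ)·𝓕(t₁ ↦ Φ(t₁, j))(ξ₁)`. [folklore] -/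
theorem tsum_twist_mul_fourier2_shift_eq_sum_filter (hΦ : ContDiff ℝ ∞ (Function.uncurry Φ))
    (hΦc : HasCompactSupport (Function.uncurry Φ)) {B₀ B : ℝ} (hB₀ : 0 ≤ B₀) (hB : B ≤ n)
    (hsupp : ∀ t₁ t₂, Φ t₁ t₂ ≠ 0 → B₀ < t₂ ∧ t₂ < B) (w : ZMod n → ℂ) (τ ξ₁ : ℝ) :
    ∑' s : ℤ, w (s : ZMod n) * fourier2 Φ ξ₁ ((s : ℝ) / n + τ) =
      ∑ j ∈ (Finset.univ : Finset (ZMod n)).filter (fun j ↦ B₀ < (j.val : ℝ) ∧ (j.val : ℝ) < B),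
        ZMod.dft w j * ((𝐞 (-((j.val : ℝ) * τ)) : ℂ) * 𝓕 (fun t₁ : ℝ ↦ Φ t₁ j.val) ξ₁) := by
  have hsupp' : ∀ t₁ t₂, Φ t₁ t₂ ≠ 0 → 0 < t₂ ∧ t₂ < (n : ℝ) := fun t₁ t₂ h ↦
    ⟨lt_of_le_of_lt hB₀ (hsupp t₁ t₂ h).1, lt_of_lt_of_le (hsupp t₁ t₂ h).2 hB⟩
  rw [tsum_twist_mul_fourier2_shift_eq_samples hΦ hΦc hsupp' w τ ξ₁, ← Finset.sum_filter_add_sum_filter_not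
    Finset.univ (fun j : ZMod n ↦ B₀ < (j.val : ℝ) ∧ (j.val : ℝ) < B)]
  conv_rhs => rw [← add_zero (Finset.sum _ _)]
  congr 1
  refine Finset.sum_eq_zero fun j hj ↦ ?_
  rw [fourier_slice_eq_zero_of_not_mem hsupp (Finset.mem_filter.mp hj).2, mul_zero, mul_zero]

/-- **The VOID mechanism (hypothesis form).** If the box lives on heights `B₀ < t₂ < B` (`0 ≤ B₀`, `B ≤ n`) and the DFT of
the twist vanishes at every residue `j` with `B₀ < j < B`, the twisted block term is `0`. For the trivial twist this is
`principalBlock_eq_zero_of_height_le`; for a twist of period `d` in `ℤ/n` use `dft_eq_zero_of_periodic`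
(samples only at multiples of `n/d`). [folklore] -/
theorem tsum_twist_eq_zero_of_dft_eq_zero (hΦ : ContDiff ℝ ∞ (Function.uncurry Φ))
    (hΦc : HasCompactSupport (Function.uncurry Φ)) {B₀ B : ℝ} (hB₀ : 0 ≤ B₀) (hB : B ≤ n)
    (hsupp : ∀ t₁ t₂, Φ t₁ t₂ ≠ 0 → B₀ < t₂ ∧ t₂ < B) {w : ZMod n → ℂ}
    (hw : ∀ j : ZMod n, B₀ < (j.val : ℝ) → (j.val : ℝ) < B → ZMod.dft w j = 0) (τ ξ₁ : ℝ) :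
    ∑' s : ℤ, w (s : ZMod n) * fourier2 Φ ξ₁ ((s : ℝ) / n + τ) = 0 := by
  rw [tsum_twist_mul_fourier2_shift_eq_sum_filter hΦ hΦc hB₀ hB hsupp w τ ξ₁]
  refine Finset.sum_eq_zero fun j hj ↦ ?_
  obtain ⟨h1, h2⟩ := (Finset.mem_filter.mp hj).2
  rw [hw j h1 h2, zero_mul]

/-- **VOID for a periodic twist**: if `w(x + d) = w(x)` on `ℤ/n` and every residue `j` with `B₀ < j < B` has `d·j ≠ 0`
in `ℤ/n` (for `d ∣ n`: the box `(B₀, B)` contains no multiple of `n/d`), then `Σ_s w(s)·Φ̂(ξ₁, s/n + τ) = 0`. [folklore] -/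
theorem tsum_twist_eq_zero_of_periodic (hΦ : ContDiff ℝ ∞ (Function.uncurry Φ))
    (hΦc : HasCompactSupport (Function.uncurry Φ)) {B₀ B : ℝ} (hB₀ : 0 ≤ B₀) (hB : B ≤ n)
    (hsupp : ∀ t₁ t₂, Φ t₁ t₂ ≠ 0 → B₀ < t₂ ∧ t₂ < B) {w : ZMod n → ℂ} {d : ZMod n}
    (hw : ∀ x, w (x + d) = w x) (hd : ∀ j : ZMod n, B₀ < (j.val : ℝ) → (j.val : ℝ) < B → d * j ≠ 0) (τ ξ₁ : ℝ) :
    ∑' s : ℤ, w (s : ZMod n) * fourier2 Φ ξ₁ ((s : ℝ) / n + τ) = 0 :=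
  tsum_twist_eq_zero_of_dft_eq_zero hΦ hΦc hB₀ hB hsupp (fun j h1 h2 ↦ dft_eq_zero_of_periodic hw (hd j h1 h2)) τ ξ₁

/-- **Primitive characters sample every height with a Gauss-sum factor**: for `χ mod n` primitive and a box below height
`n`, `Σ_{s∈ℤ} χ(s)·Φ̂(ξ₁, s/n + τ) = τ(χ)·Σ_{j mod n} χ⁻¹(−j)·e(−jτ)·𝓕(t₁ ↦ Φ(t₁, j))(ξ₁)`. [folklore] -/
theorem tsum_char_mul_fourier2_shift_eq_samples (hΦ : ContDiff ℝ ∞ (Function.uncurry Φ))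
    (hΦc : HasCompactSupport (Function.uncurry Φ))
    (hsupp : ∀ t₁ t₂, Φ t₁ t₂ ≠ 0 → 0 < t₂ ∧ t₂ < n) {χ : DirichletCharacter ℂ n} (hχ : χ.IsPrimitive) (τ ξ₁ : ℝ) :
    ∑' s : ℤ, χ (s : ZMod n) * fourier2 Φ ξ₁ ((s : ℝ) / n + τ) =
      gaussSum χ ZMod.stdAddChar *
        ∑ j : ZMod n, χ⁻¹ (-j) * ((𝐞 (-((j.val : ℝ) * τ)) : ℂ) * 𝓕 (fun t₁ : ℝ ↦ Φ t₁ j.val) ξ₁) := by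
  rw [tsum_twist_mul_fourier2_shift_eq_samples hΦ hΦc hsupp (χ : ZMod n → ℂ) τ ξ₁, Finset.mul_sum]
  refine Finset.sum_congr rfl fun j _ ↦ ?_
  rw [dft_eq_of_isPrimitive hχ]
  ring

/-- **Signed moduli**: for `h₁ ≠ 0` with `|h₁| = n`, `Σ_s w(s)·Φ̂(ξ₁, s/h₁ + τ) = Σ_s w(σ s)·Φ̂(ξ₁, s/n + τ)` where `σ = 1` if
`h₁ > 0` and `σ = −1` if `h₁ < 0` (re-index `s ↦ −s`), written with `Int.sign h₁`. [folklore] -/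
theorem tsum_twist_intShift_eq_natAbs (w : ℤ → ℂ) (F : ℝ → ℂ) {h₁ : ℤ} (hh : h₁ ≠ 0) (τ : ℝ) :
    ∑' s : ℤ, w s * F ((s : ℝ) / h₁ + τ) =
      ∑' s : ℤ, w (Int.sign h₁ * s) * F ((s : ℝ) / (h₁.natAbs : ℝ) + τ) := by
  rcases lt_or_gt_of_ne hh with hneg | hpos
  · rw [Int.sign_eq_neg_one_of_neg hneg, ← (Equiv.neg ℤ).tsum_eq]
    refine tsum_congr fun s ↦ ?_
    rw [Equiv.neg_apply, div_eq_neg_div_natAbs_of_neg hneg, neg_neg, neg_one_mul]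
  · rw [Int.sign_eq_one_of_pos hpos]
    have habs : ((h₁.natAbs : ℕ) : ℝ) = (h₁ : ℝ) := by
      rw [Nat.cast_natAbs, abs_of_pos (by exact_mod_cast hpos)]
    simp_rw [one_mul, habs]

end Twisted

/-! ### §3 The assembled a8S object: the `s`-sum of the small-conductor parts -/

section SmallPart

variable {n : ℕ}

/-- **The `s`-sum of the small-conductor parts is a sum of character-twisted complete `s`-sums.** For a finite set of
levels `G`, box weights `Φ_q` (smooth, compact support), `h₁ ≠ 0`, bookkeeping modulus `n ≥ 1`, frequencies `ξ₁ q`,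
shifts `τ q`, and classes `a(s) = A(s mod n)` that are a function of `s mod n` (for a8S: `A x = −ab·(c·x)⁻¹`):
`Σ'_s levelSmallPart R G x_s n (a s) = φ(n)⁻¹·Σ_{χ mod n, 1 < cond χ ≤ R} Σ_{q∈G} χ(q)·Σ'_s χ((A s)⁻¹)·Φ̂_q(ξ₁ q, s/h₁ + τ q)`
with `x_s q = Φ̂_q(ξ₁ q, s/h₁ + τ q)`; each inner series is a twisted complete sum of §2 (twist `w = χ((A ·)⁻¹)`, after
`tsum_twist_intShift_eq_natAbs`). [folklore] -/
theorem tsum_levelSmallPart_eq_sum_twist (R : ℕ) (G : Finset ℕ) (Φ : ℕ → ℝ → ℝ → ℂ)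
    (hΦ : ∀ q ∈ G, ContDiff ℝ ∞ (Function.uncurry (Φ q)))
    (hΦc : ∀ q ∈ G, HasCompactSupport (Function.uncurry (Φ q)))
    {h₁ : ℤ} (hh : h₁ ≠ 0) (ξ₁ τ : ℕ → ℝ) (A : ZMod n → ZMod n) :
    ∑' s : ℤ, levelSmallPart R G (fun q ↦ fourier2 (Φ q) (ξ₁ q) ((s : ℝ) / h₁ + τ q)) n (A (s : ZMod n)) =
      ((Nat.totient n : ℂ))⁻¹ *
        ∑ χ ∈ (Finset.univ : Finset (DirichletCharacter ℂ n)).filter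
            (fun χ ↦ 1 < χ.conductor ∧ χ.conductor ≤ R),
          ∑ q ∈ G, χ q * ∑' s : ℤ, χ (A (s : ZMod n))⁻¹ * fourier2 (Φ q) (ξ₁ q) ((s : ℝ) / h₁ + τ q) := by
  -- each `(χ, q)` series is summable (twist of norm ≤ 1)
  have hsum : ∀ χ : DirichletCharacter ℂ n, ∀ q ∈ G,
      Summable fun s : ℤ ↦ χ (A (s : ZMod n))⁻¹ * fourier2 (Φ q) (ξ₁ q) ((s : ℝ) / h₁ + τ q) :=
    fun χ q hq ↦ summable_twist_mul_fourier2_shift (hΦ q hq) (hΦc q hq) hh (τ q) (ξ₁ q) (M := 1)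
      fun s ↦ DirichletCharacter.norm_le_one χ _
  -- unfold and exchange: `Σ'_s φ⁻¹ Σ_χ χ(a⁻¹) Σ_q x_s q χ q = φ⁻¹ Σ_χ Σ_q χ q Σ'_s χ(a⁻¹) x_s q`
  simp only [levelSmallPart]
  rw [tsum_mul_left]
  congr 1
  have hsum' : ∀ χ ∈ (Finset.univ : Finset (DirichletCharacter ℂ n)).filter
      (fun χ ↦ 1 < χ.conductor ∧ χ.conductor ≤ R),
      Summable fun s : ℤ ↦ χ (A (s : ZMod n))⁻¹ *
        ∑ q ∈ G, fourier2 (Φ q) (ξ₁ q) ((s : ℝ) / h₁ + τ q) * χ q := by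
    intro χ _
    have : (fun s : ℤ ↦ χ (A (s : ZMod n))⁻¹ * ∑ q ∈ G, fourier2 (Φ q) (ξ₁ q) ((s : ℝ) / h₁ + τ q) * χ q) =
        fun s : ℤ ↦ ∑ q ∈ G, χ q * (χ (A (s : ZMod n))⁻¹ * fourier2 (Φ q) (ξ₁ q) ((s : ℝ) / h₁ + τ q)) := by
      funext s
      rw [Finset.mul_sum]
      exact Finset.sum_congr rfl fun q _ ↦ by ring
    rw [this]
    exact summable_sum fun q hq ↦ (hsum χ q hq).mul_left _
  rw [Summable.tsum_finsetSum hsum']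
  refine Finset.sum_congr rfl fun χ _ ↦ ?_
  have hre : (fun s : ℤ ↦ χ (A (s : ZMod n))⁻¹ * ∑ q ∈ G, fourier2 (Φ q) (ξ₁ q) ((s : ℝ) / h₁ + τ q) * χ q) =
      fun s : ℤ ↦ ∑ q ∈ G, χ q * (χ (A (s : ZMod n))⁻¹ * fourier2 (Φ q) (ξ₁ q) ((s : ℝ) / h₁ + τ q)) := by
    funext s
    rw [Finset.mul_sum]
    exact Finset.sum_congr rfl fun q _ ↦ by ring
  rw [hre, Summable.tsum_finsetSum (fun q hq ↦ (hsum χ q hq).mul_left _)]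
  exact Finset.sum_congr rfl fun q _ ↦ by rw [tsum_mul_left]

end SmallPart

end Summit.Parity.GeneralizedHardyLittlewood.Theorems.BeyondDiagonalBeatsQuarter.OffDiag
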